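import Mathlib
import HarnessLib
import HarnessLib.Audit
import Summits.AtomisticToContinuum.Statement

/-!
Route: FrustrationRangeLP

CLOSED (retired) 2026-08-15T13:42:45Z by operator:999:1257524 — reason: not-a-thesis: assembly does not conclude the sub-problem Statement — note: D-0027 §2.1 audit (human 2026-08-15: routes that do not decide the summit are removed): the assembly concludes `Literature.MathematicalPhysics.StatisticalMechanics.Crystallization`, not the sub-problem statement; a NEW conforming route may be opened from the same idea (generated `closes : … → _root_. The file is kept as the record of this route; refuted decls are indexed as negative knowledge (`ledger negatives`).

Route FrustrationRangeLP — realises idea card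
AtomisticToContinuum/Crystallization/frustration-range-lp-hierarchy ("the frustration range of
Lennard-Jones: local-optimality certificates as LP duals of a unimodular marginal hierarchy").

It suffices to show X = COORDINATION-GAP TRANSFER CERTIFICATES AT FINITE LEVEL (decl
CoordinationGapCertificates):
for every tolerance eta in (0, 3/10) and every defect budget theta > 0 there are a level R <
infinity, constants c and kappa > 0, a separation delta > 0 obeyed by all Lennard-Jones ground
states (delta = 1/3 is proved: LennardJonesMinimalDistance_holds), and a PATTERN-LOCAL TRANSFER RULE
Phi(v, P_R(i), P_R(j)) — the energy sent from particle i to particle j at relative position v, |v|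
<= R, allowed to depend only on the two R-neighbourhood patterns — such that on EVERY finite
delta-separated configuration x_1..x_N in R^3 and at every particle i
   (1/2) Sum_{j != i} V_LJ(|x_i - x_j|) + Sum_{j : |x_j - x_i| <= R} [Phi(i->j) - Phi(j->i)]  >=  c
+ kappa * 1[i is NOT softly twelve-coordinated],
where "softly twelve-coordinated" = exactly 12 other particles within 1+eta and none at distance in
(1+eta, 5/4) (the local predicate of SoftTwelveCoordination, route CrystalKissingRigidity), with the
BUDGET  e* - c <= kappa*theta,  e* = inf over periodic Q of e(Q).
The transfers are zero-sum on every finite configuration, so for a ground state Sum_i(...) = E(N)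
and #defects <= N (E(N)/N - c)/kappa <= N (E(N)/N - e*)/kappa + theta N. Hence X + [E(N)/N -> e*]
(shared item 0626) => SoftTwelveCoordination (K1) => [borrowed back end of CrystalKissingRigidity:
robust Fejes Toth-Hales K2 + stacking selection + hinge, filed here as ONE support item
KissingBackEnd] IsCrystallizing; with the shared periodic-minimum item 0627 this is Crystallization
(decl Assembly, a five-line composition).
WHY THIS IS AN LP ROUTE: by transfer/marginal duality (crux TransferDuality) the best constant
certifiable at level R equals the minimum of E_mu[site energy/2] over rooted laws mu consistent
under mass transport for R-local pattern tests (continuum Kaburagi-Kanamori configurational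
polytope; m-potentials <-> zero-sum transfers, Holsztynski-Slawny); levels increase to e*, and X <=>
a positive DEFECT PRICE: every unimodular delta-separated law pays >= kappa per unit mass of
coordination defects. Its periodic shadow is crux PeriodicCoordinationGap; the primal optima at low
levels (frustrated icosahedral/polytetrahedral pseudo-laws, cutoff artefacts) are the refutation
engine FrustrationFloor that measures the frustration range R*(eta, theta).

Lean (decl CoordinationGapCertificates, elaborates against Mathlib +
Summits.AtomisticToContinuum.Statement):
∀ η : ℝ, 0 < η → η < 3 / 10 → ∀ θ : ℝ, 0 < θ → ∃ (δ R c κ : ℝ) (Φ : EuclideanSpace ℝ (Fin 3) →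
Finset (EuclideanSpace ℝ (Fin 3)) → Finset (EuclideanSpace ℝ (Fin 3)) → ℝ), 0 < δ ∧ 0 < κ ∧ (∀ (N :
ℕ) (x : Fin N → EuclideanSpace ℝ (Fin 3)),
Literature.MathematicalPhysics.StatisticalMechanics.IsGroundState
Literature.MathematicalPhysics.StatisticalMechanics.lennardJones x → ∀ i j : Fin N, i ≠ j → δ ≤ dist
(x i) (x j)) ∧ (⨅ Q : Literature.MathematicalPhysics.StatisticalMechanics.PeriodicConfiguration 3,
Q.energyPerParticle Literature.MathematicalPhysics.StatisticalMechanics.lennardJones) - κ * θ ≤ c ∧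
∀ (N : ℕ) (x : Fin N → EuclideanSpace ℝ (Fin 3)), (∀ i j : Fin N, i ≠ j → δ ≤ dist (x i) (x j)) →
let pat : Fin N → Finset (EuclideanSpace ℝ (Fin 3)) := fun i => Finset.image (fun k : Fin N => x k -
x i) (Finset.univ.filter fun k : Fin N => k ≠ i ∧ dist (x i) (x k) ≤ R); ∀ i : Fin N, c + (if
(Nat.card {j : Fin N // j ≠ i ∧ dist (x i) (x j) ≤ 1 + η} = 12 ∧ ∀ j : Fin N, j ≠ i → dist (x i) (x
j) ≤ 1 + η ∨ 5 / 4 ≤ dist (x i) (x j)) then 0 else κ) ≤ (∑ j ∈ Finset.univ.erase i,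
Literature.MathematicalPhysics.StatisticalMechanics.lennardJones (dist (x i) (x j))) / 2 + ∑ j ∈
Finset.univ.erase i, (if dist (x i) (x j) ≤ R then Φ (x j - x i) (pat i) (pat j) - Φ (x i - x j)
(pat j) (pat i) else 0)

Rationale: WHY THIS LINE. Every proved crystallization theorem for realistic potentials rests on a LOCAL energy
inequality "e_loc >= e*" (Theil2006; FlatleyTheil2015 with a three-body crutch; BlancLewin2015
§2.3), and crux (a) of route CrystalLocalRigidity asks for exactly such an e_loc for Lennard-Jones
in R^3 without saying where it comes from. This route imports CONVEX DUALITY from lattice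
statistical mechanics and alloy theory: a localised energy with zero-sum corrections is a DUAL
CERTIFICATE (m-potential <-> transfers, HolsztynskiSlawny1978; Lagarias2002LocalDensity's score
functions for packings; Hales's Flyspeck transfers, Hales2012), and its existence at level R is
equivalent to tightness of a PRIMAL relaxation over mass-transport-consistent rooted laws on
R-patterns (KaburagiKanamori1975's configurational polytope, run as certified hierarchies on Z^d by
HuangEtAl2016 (LP + MAX-SAT) and KullEtAl2024 (SDP); continuum pair/3-point levels without locality:
CohnKumar2006, Li2022, CohnLaatSalmon2022, Laat2016, DelaatVallentin2014). Planning found that EXACT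
finite-range certificates for the Lennard-Jones energy cannot exist (far density perturbations of
the r^-6 tail have indefinite local sign; truncation instead produces cutoff artefacts), so the
thesis carries a DEFECT BUDGET theta and uses full-range one-centre energies with finite-range
transfers: level values then converge to e* by soft compactness (TransferDuality) and the content
left is a positive PRICE OF COORDINATION DEFECTS, while the primal side supplies rigorous no-go
witnesses and, with a tail bound, the first rigorous lower bounds on e*_LJ(3D) (none exist:
Yuhjtman2015, DelimaProcacciYuhjtman2015 give 8.61 <= B_LJ <= 14.316 only).
Imported areas — LP/convex duality and Sherali-Adams-type marginal hierarchies (lattice ground-state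
theory), unimodular/Palm point processes (mass transport, AldousLyons2007), certified computation
(interval LP, column generation), Flyspeck-type local inequalities.

RANKED CRUXES (decls of Theses/FrustrationRangeLP.lean):
 #2 CoordinationGapCertificates [typed] — X itself: for all eta, theta a finite level R with a
pattern-local transfer rule, gap kappa > 0 off the softly-12-coordinated patterns and budget e* - c
<= kappa*theta (why it might fail: the defect price is zero — coordination defects asymptotically
free, or a non-close-packed / polytetrahedral law degenerate with e*, i.e. K1 itself fails; or only
with a separation far above the proved 1/3; sources HolsztynskiSlawny1978, KaburagiKanamori1975,
KullEtAl2024).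
 #3 PeriodicCoordinationGap [typed] — primal shadow on periodic configurations: e(Q) >= e* + kappa *
(fraction of motif sites not softly 12-coordinated), kappa(eta) > 0 uniform in Q; refutable by
cheap-defect crystals, certifiable from below by finite-level LPs + lattice sums (why it might fail:
kappa(eta) -> 0 along near-degenerate tcp structures — A15/sigma within ~1.5e-2 of e*, hcp/fcc
margin 7e-5; sources BlancLewin2015, BeterminSamajTravenec2022, Stillinger2001).
 #4 TransferDuality [informal, filed after open; definition requests LensConsistentLaw,
transferLevelValue] — weak/strong duality at each level (Sion minimax on the vaguely compact space
of rooted delta-separated configurations), monotonicity in R and convergence of level values to e* =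
inf periodic = lim E(N)/N; makes R*(eta,theta) well defined and turns X into "positive defect price
over unimodular laws" (why it might fail: only in the identification e* = inf specific energy over
stationary delta-separated processes for the chosen delta).
 #5 FrustrationFloor [informal, filed after open; certified numerics] — the refutation engine on the
R-truncated program: cutoff artefacts (bcc-type 8+6 beats every Barlow stacking for cutoffs in
~(1.13, 1.68): -0.5096 vs -0.5000 at 5/4, uncertified), certified level values and primal pseudo-law
witnesses at R in {1.8, 2.1, 2.4}, tail entered as a density (pressure) bound; claim R*_tr > 1.8,
bet R*_tr <= 2.5 (Flyspeck's hybrid radius is 1.26 diameters) (why it might fail: intractable at R =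
1.8 already; tail slack ~ delta^-3 R^-3 swamps margins unless the minimal distance of ground states
is sharpened well beyond 1/3).

SUPPORT: CoordinationFromCertificates (X + 0626 => SoftTwelveCoordination; counting, typed),
KissingBackEnd (SoftTwelveCoordination => IsCrystallizing; = K2 0758 + hinge 0751 + 0752 + 0759 of
CrystalKissingRigidity, borrowed, not staffed here), shared 0626 (CrysEnergyLimit) and 0627
(CrysPeriodicMinAttained), Assembly (composition, typed, proof checked in Sketch.lean).

TWO-LAYER PLAN. Foreseen glued split of #2 once #3 or #5 moves: CoordinationGapCertificates <=
[FarFieldTransfer: a radial long-range 'pressure' transfer absorbing far-field density at separation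
delta] -> [NearFieldCertificate: level-R pattern LP with gap kappa certified by interval arithmetic]
-> [LevelLift: TransferDuality's monotone lift to all theta]; k = 3, depth 1.

KILL CRITERIA. (i) A refutation of PeriodicCoordinationGap by an explicit periodic structure with
defect cost/defect fraction -> 0 at fixed eta kills X for that eta (and K1-type routes with it).
(ii) A proof that level values stay bounded away from e* (failure of TransferDuality (iii)) kills
the LP mechanism, not the conjecture. (iii) SoftTwelveCoordination refuted (icosahedral order
persists in LJ ground states) kills this route and CrystalKissingRigidity together. (iv) If
FrustrationFloor shows R*_tr > 2.5 at every tractable precision the route goes dormant as a proof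
route and survives only as the no-go / lower-bound engine.

NOT DECOMPOSED YET. The form of Phi (two-tier: pattern-dependent short transfers + radial long-range
'pressure' transfer), the discretisation/Lipschitz scheme, symmetry reduction by O(3), the
tail-as-pressure lemma (Kepler-type density bound at the ground-state minimal distance — other
cards: theta-universality-packings, cage-bootstrap-minimal-distance), equality cases / complementary
slackness (card B4), and everything downstream of K1 (owned by CrystalKissingRigidity). All wait for
crux #3 or #5 to move.

CHEAPEST FALSIFIER. Refute PeriodicCoordinationGap numerically at eta = 1/5: relax Lennard-Jones
energies of tcp/Frank-Kasper phases (A15, sigma, C15) and of strained hcp supercells and tabulate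
(e(Q) - e(hcp)) / (defect fraction); a value below ~1e-3 means the defect price is ~0 and X is dead
at that eta. Runner-up: set up the level-(5/4) truncated LP (first shell, <= 13 movable neighbours
at separation >= 0.9); if even that cannot be certified, FrustrationFloor never starts.

NUMBERS. e(hcp) = -0.7176 (BlancLewin units, V = r^-12/12 - r^-6/6, a* = 0.971); V(1) = -1/12; delta
= 1/3 proved (LennardJonesMinimalDistance_holds); tail half-sum beyond R at close-packed density ~
0.49 R^-3 (0.018 at R = 3); worst-case tail at separation 1/3 ~ 25 R^-3 (useless below R ~ 17);
elastic cost of a 3-5% dilation 0.015-0.046 per particle; vacancy cost per induced defect ~0.06; bcc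
window of the truncated program ~(1.13, 1.68); fcc beats hcp by 0.011 at cutoff 1.8 (true hcp-fcc =
-7e-5): all planner estimates, uncertified, recorded in NOTES.md.

SOURCES. BlancLewin2015 §2.2-2.3; Theil2006; FlatleyTheil2015; HolsztynskiSlawny1978; Miekisz1993,
Miekisz1998; KaburagiKanamori1975; HuangEtAl2016; KullEtAl2024; DelaatVallentin2014; Laat2016;
CohnKumar2006; Li2022; CohnLaatSalmon2022; Lagarias2002LocalDensity; Hales2012; HalesDSP2012 §6.3.2;
Radin1987; AldousLyons2007; Yuhjtman2015; DelimaProcacciYuhjtman2015; BeterminSamajTravenec2022;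
Stillinger2001; PartayOrtnerCsanyi2017; LennardJonesClusters.lean (delta = 1/3, removal inequality).

DEFINITION REQUESTS. LensConsistentLaw (finitely supported rooted-pattern laws with level-(R,r)
mass-transport identities) and transferLevelValue (the dual value v(R) as an sSup over pattern-local
transfer rules; full-range and R-truncated variants), topic
Summits/AtomisticToContinuum/Crystallization/Theorems, for TransferDuality / FrustrationFloor.

Novelty: NOVELTY (grade claimed: new-combination; agrees with the refuter's novelty audit of the card,
2026-08-15).
Searched (this session): lit cite/crossref for doi:10.1007/bf01609493, 10.1143/ptp.54.30,
10.1103/physrevb.94.134424, 10.1103/physrevx.14.021008, 10.1007/bf01058430,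
10.1007/s10107-014-0843-4 (all resolved, added to references.bib); lit vsearch "linear programming
duality between local energy lower bounds with transfers and consistent local marginal distributions
for particle configurations" (only generic convex-optimisation textbooks: carlier2021, borwein2000,
blekherman2012 — no particle-system hit); lit galaxy search "configurational polytope" --star all (3
hits, all ALLOY-LATTICE theory: de Fontaine LBL 1984 'feasibility of ab initio ordering phase
diagrams', Ceder–Garbulsky PRB 49 (1994) fcc ternary ground states — confirms the primal object is
classical on lattices and absent for continuum particles); lit frontier AtomisticToContinuum --since
2020 (30 newest descendants: kinetic theory / Bose gas / heat conduction only, nothing on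
certificates for crystallization); the card's own searches (crossref/vsearch 'linear programming
ground state continuum particles local correlations', 'Kanamori continuum': none) and the refuter's
(zbMATH Miekisz frustration; HS m-potentials). lit search (local FTS) and a second galaxy query were
unavailable (searchd connection reset / galaxyd queue saturated, D-0023) — recorded in NOTES.md, not
worked around.
Nearest prior art actually f  [refs: 10.1007/bf01609493, 10.1143/ptp.54.30, 10.1103/physrevb.94.134424, 10.1103/physrevx.14.021008, 10.1007/bf01058430, 10.1007/s10107-014-0843-4, doi:10.1007/bf01609493, KaburagiKanamori1975, HolsztynskiSlawny1978, Miekisz1993, Miekisz1998, HuangEtAl2016, KullEtAl2024, CohnKumar2006, Li2022, CohnLaatSalmon2022, Laat2016, DelaatVallentin2014, Hales2012, HalesDSP2012, Theil2006, FlatleyTheil2015]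

Barriers (technique_class: marginal-LP-hierarchy; transfer-duality; certified-LP): - technique_class: marginal-LP-hierarchy; transfer-duality; certified-LP
- Literature.Barriers.AtomisticToContinuum.Li2022_cohnElkies3D: APPLIES to the pair-marginal level
only (two-point LP has a duality gap for packing in d = 3; its scope caveat (b) says nothing is
known for the (12,6) energy program). Evaded by construction: the hierarchy's variables are full
rooted R-patterns with mass-transport consistency (all k-point marginals inside B_R at once), of
which the two-point program is the lowest level; the bet is finite-level tightness UP TO A DEFECT
BUDGET, never two-point sharpness.
- Literature.Barriers.AtomisticToContinuum.TetrahedralFrustration: APPLIES to raw single-cell levels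
(pure Voronoi / pure Delaunay functionals without reapportioning are not sharp: 0.7547, 0.7797 vs
0.7405). The transfer rule Phi IS the reapportioning ('zero-sum corrections' of Lagarias's
admissible class, evasion (i) of the narrowed barrier); the route does not evade frustration by fiat
— crux FrustrationFloor measures the level at which it is resolved (bet R*_tr <= 2.5, cf. Marchal
cells at radius 1.26 diameters), and the thesis carries a defect budget theta so that unresolved
frustration at finite level costs budget, not validity.
- Literature.Barriers.AtomisticToContinuum.IcosahedralClusters: APPLIES as a fact about finite N
(LJ_13 is icosahedral) and is used as a RESOURCE: icosahedral/polytetrahedral local statistics are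
the primal witnesses of FrustrationFloor; the certificate inequalit

Novelty grade: new-combination — refuter route-review grade: NEW-COMBINATION (agrees with the card-level novelty audit cited by the planner). The two joined knowns: (a) m-potential/transfer ⇔ marginal-LP duality for LATTICE ground states (Holsztynski–Slawny 1978; Kaburagi–Kanamori configurational polytope; certified hierarchies Hua (refuter refuter-rreview-route-KontsevichZagierPe-b1cffd87-0, 2026-08-15T13:39:09Z; prior: HolsztynskiSlawny1978 (doi:10.1007/bf01609493), KaburagiKanamori1975 (doi:10.1143/ptp.54.30), HuangEtAl2016, KullEtAl2024, Lagarias2002LocalDensity, Hales2012, CohnKumar2006, Li2022, Theil2006, FlatleyTheil2015)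

History (route lifecycle, newest last):
- 2026-08-15T13:42:45Z · CLOSED retired — not-a-thesis: assembly does not conclude the sub-problem Statement (operator:999:1257524)

sub-problem: Crystallization · status: closed(retired) · opened planner-plancard-AtomisticToContinuum-Crystal-9bb6b7da-0 2026-08-15T11:17:45Z · rev 0 · ledger route-AtomisticToContinuum-FrustrationRangeLP
GENERATED by the gate from the ledger (D-0016/17). Provers cite these decls: `theorem foo : Summit.AtomisticToContinuum.Crystallization.Theses.FrustrationRangeLP.<Decl> := …` in Summits/AtomisticToContinuum/Crystallization/Theorems/<Name>.lean.
-/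

namespace Summit.AtomisticToContinuum.Crystallization.Theses.FrustrationRangeLP

open scoped BigOperators Topology Manifold Classical MeasureTheory ProbabilityTheory Matrix InnerProductSpace ComplexConjugate ContinuousMap
open Filter Set Function TopologicalSpace MeasureTheory

attribute [summit_statement] _root_.Crystallization

/-- item stmt-AtomisticToContinuum-3423 · crux · rank 2 · closed · moot by None · by planner
why it might fail: The defect price may vanish: coordination defects asymptotically free, or a non-close-packed / polytetrahedral unimodular law degenerate with e* (⇔ K1 false); and far-field density at separation 1/3 may push R(θ) to astronomically large levels (existence survives, certifiability not).
sources: HolsztynskiSlawny1978, KaburagiKanamori1975, KullEtAl2024, HuangEtAl2016, Hales2012, Lagarias2002LocalDensity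
[crux] COORDINATION-GAP TRANSFER CERTIFICATES (thesis X; dual side of the level-R unimodular
marginal LP): for every η ∈ (0,3/10) and θ > 0 there are a level R, a separation δ > 0 valid for all
Lennard-Jones ground states (1/3 is proved), constants c, κ > 0 and a PATTERN-LOCAL transfer rule
Φ(v, P_R(i), P_R(j)) such that on every finite δ-separated configuration, pointwise, ½ Σ_j V_LJ(|x_i
− x_j|) + Σ_{|x_j − x_i| ≤ R} [Φ(i→j) − Φ(j→i)] ≥ c + κ·1[i NOT softly twelve-coordinated, i.e.
¬(exactly 12 within 1+η ∧ none in (1+η, 5/4))], with budget e* − c ≤ κθ (e* = ⨅ periodic e).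
Transfers are antisymmetrised hence zero-sum, so #defects ≤ N(E(N)/N − e*)/κ + θN (support
CoordinationFromCertificates). By TransferDuality equivalent to a positive DEFECT PRICE over
unimodular δ-separated laws; finite levels are certified LPs (continuum Kaburagi–Kanamori polytope).
Full-range one-centre energy with finite-range transfers is deliberate: exact finite-range
certificates (the card's literal X) are refutable through the r⁻⁶ tail, truncated ones through
cutoff artefacts (route rationale). [difficulty: open-problem] -/
@[route_item "route-AtomisticToContinuum-FrustrationRangeLP"]
def CoordinationGapCertificates : Prop :=
  ∀ η : ℝ, 0 < η → η < 3 / 10 → ∀ θ : ℝ, 0 < θ → ∃ (δ R c κ : ℝ) (Φ : EuclideanSpace ℝ (Fin 3) → Finset (EuclideanSpace ℝ (Fin 3)) → Finset (EuclideanSpace ℝ (Fin 3)) → ℝ), 0 < δ ∧ 0 < κ ∧ (∀ (N : ℕ) (x : Fin N → EuclideanSpace ℝ (Fin 3)), Literature.MathematicalPhysics.StatisticalMechanics.IsGroundState Literature.MathematicalPhysics.StatisticalMechanics.lennardJones x → ∀ i j : Fin N, i ≠ j → δ ≤ dist (x i) (x j)) ∧ (⨅ Q : Literature.MathematicalPhysics.StatisticalMechanics.PeriodicConfiguration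 3, Q.energyPerParticle Literature.MathematicalPhysics.StatisticalMechanics.lennardJones) - κ * θ ≤ c ∧ ∀ (N : ℕ) (x : Fin N → EuclideanSpace ℝ (Fin 3)), (∀ i j : Fin N, i ≠ j → δ ≤ dist (x i) (x j)) → let pat : Fin N → Finset (EuclideanSpace ℝ (Fin 3)) := fun i => Finset.image (fun k : Fin N => x k - x i) (Finset.univ.filter fun k : Fin N => k ≠ i ∧ dist (x i) (x k) ≤ R); ∀ i : Fin N, c + (if (Nat.card {j : Fin N // j ≠ i ∧ dist (x i) (x j) ≤ 1 + η} = 12 ∧ ∀ j : Fin N, j ≠ i → dist (x i) (x j) ≤ 1 + η ∨ 5 / 4 ≤ dist (x i) (x j)) then 0 else κ) ≤ (∑ j ∈ Finset.univ.erase i, Literature.MathematicalPhysics.StatisticalMechanics.lennardJones (dist (x i) (x j))) / 2 + ∑ j ∈ Finset.univ.erase i, (if dist (x i) (x j) ≤ R then Φ (x j - x i) (pat i) (pat j) - Φ (x i - x j) (pat j) (pat i) else 0)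

/-- item stmt-AtomisticToContinuum-3424 · crux · rank 3 · closed · moot by None · by planner
why it might fail: κ(η) could be 0: periodic structures (tcp/Frank–Kasper-like, or strained supercells) with excess energy o(defect fraction); the landscape is flat (hcp − fcc = −7e-5; A15 within ~1.5e-2) and no rigorous lower bound on e* exists to anchor the comparison.
sources: BlancLewin2015, BeterminSamajTravenec2022, Stillinger2001, PartayOrtnerCsanyi2017, KaburagiKanamori1975
[crux] PERIODIC COORDINATION GAP (primal shadow of X on periodic laws; the certified-numerics target
both ways): for every η ∈ (0,3/10) there is κ > 0 with e(Q) ≥ e* + κ · (fraction of motif sites of Q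
that are not softly twelve-coordinated in Q.points) for EVERY periodic configuration Q of ℝ³ (any
full-rank lattice, any finite motif; no separation hypothesis: close pairs pay r⁻¹²). Lower bounds:
finite-level LPs of this route + lattice sums; refutation: explicit crystals. Planner's uncertified
estimates of cost per defect site (V = r⁻¹²/12 − r⁻⁶/6, e* ≈ e(hcp) = −0.7176): vacancy ≈ 0.06, 3–5
% dilation ≈ 0.015–0.05, bcc ≈ 0.03, A15/σ tcp phases ≈ 0.012/0.75. Needs BddBelow of the periodic
energies (item 0714) for ⨅ to be the true infimum. [difficulty: L] -/
@[route_item "route-AtomisticToContinuum-FrustrationRangeLP"]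
def PeriodicCoordinationGap : Prop :=
  ∀ η : ℝ, 0 < η → η < 3 / 10 → ∃ κ : ℝ, 0 < κ ∧ ∀ Q : Literature.MathematicalPhysics.StatisticalMechanics.PeriodicConfiguration 3, (⨅ Q' : Literature.MathematicalPhysics.StatisticalMechanics.PeriodicConfiguration 3, Q'.energyPerParticle Literature.MathematicalPhysics.StatisticalMechanics.lennardJones) + κ * ((Set.ncard {y : EuclideanSpace ℝ (Fin 3) | y ∈ Q.motif ∧ ¬ ({z ∈ Q.points | z ≠ y ∧ dist y z ≤ 1 + η}.ncard = 12 ∧ ∀ z ∈ Q.points, z ≠ y → dist y z ≤ 1 + η ∨ 5 / 4 ≤ dist y z)} : ℝ) / (Q.motif.card : ℝ)) ≤ Q.energyPerParticle Literature.MathematicalPhysics.StatisticalMechanics.lennardJones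

-- item stmt-AtomisticToContinuum-3485 · support · rank 4 · closed · moot by None · by planner — informal only, no Lean statement yet:
--   [crux] TRANSFER DUALITY AND LEVEL CONVERGENCE (makes the frustration range well defined; conceptual
--   heart of the card). Fix δ > 0 (a separation valid for LJ ground states) and a level R. DUAL value
--   v(R) := sup{c : ∃ pattern-local transfer rule Φ(v, P_R(i), P_R(j)) with ½Σ_j V_LJ(|x_i−x_j|) +
--   Σ_{|x_j−x_i|≤R}[Φ(i→j)−Φ(j→i)] ≥ c at every particle of every finite δ-separated configuration} (the
--   κ = 0 case of CoordinationGapCertificates). PRIMAL value p(R) := inf{E_μ[½Σ_{v∈ω∖0} V_LJ(|v|)] : μ a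
--   probability law on rooted δ-separated locally finite configurations (ω,0) ⊂ ℝ³ satisfying the
--   level-R mas

-- item stmt-AtomisticToContinuum-3504 · support · rank 5 · closed · moot by None · by planner — informal only, no Lean statement yet:
--   [crux] FRUSTRATION FLOOR — certified level values of the R-TRUNCATED program (the card's refutation
--   engine B2/B3; certified numerics). For the truncated one-centre energy u_R(i) = Σ_{0<|x_j−x_i|≤R}
--   V_LJ(|x_i−x_j|) the level-R value v_tr(R) := sup{c : ∃ pattern-local Φ of range R with u_R/2 + div_Φ
--   ≥ c pointwise on (1/3)-separated finite configurations} is, after O(3)-symmetry reduction and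
--   certified discretisation (grid h with Lipschitz slack; column generation over local patterns), a
--   finite LP whose primal optima are finitely supported lens-consistent pseudo-laws on B_R-patterns
--   (continuum Ka

/-- item stmt-AtomisticToContinuum-0626 · support · rank 9 · open · by planner
Energetic crystallization: E(N)/N converges to the infimum over periodic (multi-lattice)
configurations of the LJ energy per particle in d = 3. Lower bound liminf ≥ ⨅ is the content ((a)
local optimality + (d) + surface term O(N^{2/3})); upper bound is filed separately. -/
@[route_item "route-AtomisticToContinuum-FrustrationRangeLP"]
def CrysEnergyLimit : Prop :=
  Filter.Tendsto (fun N : ℕ => Literature.MathematicalPhysics.StatisticalMechanics.groundStateEnergy Literature.MathematicalPhysics.StatisticalMechanics.lennardJones 3 N / N) Filter.atTop (nhds (⨅ Q : Literature.MathematicalPhysics.StatisticalMechanics.PeriodicConfiguration 3, Q.energyPerParticle Literature.MathematicalPhysics.StatisticalMechanics.lennardJones))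

/-- item stmt-AtomisticToContinuum-0627 · support · rank 9 · open · by planner
The infimum over periodic configurations of ℝ³ of the Lennard-Jones energy per particle is attained
(by some lattice G and finite motif F). Needs stacking selection (c) + compactness of near-optimal
periodic configurations at bounded density / bounded-below distances; refuted if optimal LJ
stackings are aperiodic with unattained infimum (route RefuteCrystalPeriodicMin). -/
@[route_item "route-AtomisticToContinuum-FrustrationRangeLP"]
def CrysPeriodicMinAttained : Prop :=
  ∃ P : Literature.MathematicalPhysics.StatisticalMechanics.PeriodicConfiguration 3, IsLeast (Set.range fun Q : Literature.MathematicalPhysics.StatisticalMechanics.PeriodicConfiguration 3 => Q.energyPerParticle Literature.MathematicalPhysics.StatisticalMechanics.lennardJones) (P.energyPerParticle Literature.MathematicalPhysics.StatisticalMechanics.lennardJones)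

/-- item stmt-AtomisticToContinuum-3425 · support · rank 9 · closed · moot by None · by planner
[support] BOOKKEEPING HINGE: CoordinationGapCertificates → (E(N)/N → ⨅ periodic e, shared item 0626)
→ SoftTwelveCoordination (K1 of CrystalKissingRigidity, item 0750, restated verbatim). Proof: the
transfer summand is antisymmetric in (i,j), so it sums to 0 over a finite configuration; Σ_i ½
Σ_{j≠i} V = E(N) for a ground state (two_mul_interactionEnergy); hence N c + κ·#bad ≤ E(N) and
#bad/N ≤ (E(N)/N − e*)/κ + θ → θ, θ arbitrary; ground states are δ-separated by the certificate's
first conjunct. [deps: CoordinationGapCertificates] [difficulty: provable-now] -/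
@[route_item "route-AtomisticToContinuum-FrustrationRangeLP"]
def CoordinationFromCertificates : Prop :=
  CoordinationGapCertificates → Filter.Tendsto (fun N : ℕ => Literature.MathematicalPhysics.StatisticalMechanics.groundStateEnergy Literature.MathematicalPhysics.StatisticalMechanics.lennardJones 3 N / N) Filter.atTop (nhds (⨅ Q : Literature.MathematicalPhysics.StatisticalMechanics.PeriodicConfiguration 3, Q.energyPerParticle Literature.MathematicalPhysics.StatisticalMechanics.lennardJones)) → ∀ η : ℝ, 0 < η → η < 3 / 10 → ∀ x : (N : ℕ) → (Fin N → EuclideanSpace ℝ (Fin 3)), (∀ N, Literature.MathematicalPhysics.StatisticalMechanics.IsGroundState Literature.MathematicalPhysics.StatisticalMechanics.lennardJones (x N)) → Filter.Tendsto (fun N : ℕ => (Nat.card {i : Fin N // ¬ (Nat.card {j : Fin N // j ≠ i ∧ dist (x N i) (x N j) ≤ 1 + η} = 12 ∧ ∀ j : Fin N, j ≠ i → dist (x N i) (x N j) ≤ 1 + η ∨ 5 / 4 ≤ dist (x N i) (x N j))} : ℝ) / N) Filter.atTop (nhds 0)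

/-- item stmt-AtomisticToContinuum-3426 · support · rank 9 · closed · moot by None · by planner
[support] BORROWED POSITIONAL BACK END: SoftTwelveCoordination → IsCrystallizing lennardJones 3.
Equals cruxes RobustFejesTothHales (0758) + BulkDefectVanish (0751) + support
DefectVanishCrystallizes (0752), StackingFaultBound (0759) of route CrystalKissingRigidity composed
with LennardJonesMinimalDistance_holds and the shared Hägg-domination items; NOT this route's
mechanism and not to be staffed from here — it records the dependency so that the Assembly is
honest. [difficulty: open-problem (owned by CrystalKissingRigidity)] -/
@[route_item "route-AtomisticToContinuum-FrustrationRangeLP"]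
def KissingBackEnd : Prop :=
  (∀ η : ℝ, 0 < η → η < 3 / 10 → ∀ x : (N : ℕ) → (Fin N → EuclideanSpace ℝ (Fin 3)), (∀ N, Literature.MathematicalPhysics.StatisticalMechanics.IsGroundState Literature.MathematicalPhysics.StatisticalMechanics.lennardJones (x N)) → Filter.Tendsto (fun N : ℕ => (Nat.card {i : Fin N // ¬ (Nat.card {j : Fin N // j ≠ i ∧ dist (x N i) (x N j) ≤ 1 + η} = 12 ∧ ∀ j : Fin N, j ≠ i → dist (x N i) (x N j) ≤ 1 + η ∨ 5 / 4 ≤ dist (x N i) (x N j))} : ℝ) / N) Filter.atTop (nhds 0)) → Literature.MathematicalPhysics.StatisticalMechanics.IsCrystallizing Literature.MathematicalPhysics.StatisticalMechanics.lennardJones 3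

/-- item stmt-AtomisticToContinuum-3427 · assembly · rank 1 · closed · moot by None · by planner
[assembly] CoordinationGapCertificates → (0626) → CoordinationFromCertificates → KissingBackEnd →
(0627) → Crystallization. Proof (checked in the planner's Sketch.lean): K1 from the hinge,
IsCrystallizing from the back end, HasPeriodicGroundStateEnergy from the attained P via
IsLeast.csInf_eq and 0626. -/
@[route_item "route-AtomisticToContinuum-FrustrationRangeLP"]
def Assembly : Prop :=
  CoordinationGapCertificates → Filter.Tendsto (fun N : ℕ => Literature.MathematicalPhysics.StatisticalMechanics.groundStateEnergy Literature.MathematicalPhysics.StatisticalMechanics.lennardJones 3 N / N) Filter.atTop (nhds (⨅ Q : Literature.MathematicalPhysics.StatisticalMechanics.PeriodicConfiguration 3, Q.energyPerParticle Literature.MathematicalPhysics.StatisticalMechanics.lennardJones)) → CoordinationFromCertificates → KissingBackEnd → (∃ P : Literature.MathematicalPhysics.StatisticalMechanics.PeriodicConfiguration 3, IsLeast (Set.range fun Q : Literature.MathematicalPhysics.StatisticalMechanics.PeriodicConfiguration 3 => Q.energyPerParticle Literature.MathematicalPhysics.StatisticalMechanics.lennardJones) (P.energyPerParticle Literature.MathematicalPhysics.StatisticalMechanics.lennardJones))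 → Literature.MathematicalPhysics.StatisticalMechanics.Crystallization

end Summit.AtomisticToContinuum.Crystallization.Theses.FrustrationRangeLP
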